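import Summits.ResolutionOfSingularities.ResolutionOfSingularities.Theorems.UniversalCellsPrimeFieldToPerfectStubClimbAlgebraic
import Mathlib.FieldTheory.RatFunc.AsPolynomial
import Mathlib.FieldTheory.PurelyInseparable.PerfectClosure
import HarnessLib

/-!
# Crux `PrimeFieldToPerfect`, line `birth` (RESHAPE 4): the kernel reduces to the perfect closure of `RatFunc M`

Route `ResolutionOfSingularities/UniversalCells`, crux `PrimeFieldToPerfect`
(stmt-ResolutionOfSingularities-15233). Helper (glue of the lead's RESHAPE 4), PROVED: the
transcendental climb (RESHAPE 3's registered stub `stub_climbTranscendental`: a perfect `M` of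
characteristic `p` with resolution in all dimensions, a perfect `L ⊇ M` and `t ∈ L` transcendental
over `M` with `L` algebraic over `M⟮t⟯` ⇒ resolution over `L`) FOLLOWS from its live case, the
registered kernel `stub_climbRatFuncPerf` of RESHAPE 4 (resolution over every perfect field purely
inseparable over the rational function field `RatFunc M`, i.e. over `M(t)^{perf}`).

**Proof.** Put `E := M⟮t⟯ ⊆ L` and `L₀ := perfectClosure E L`, the relative perfect closure: it
is perfect (as `L` is) and purely inseparable over `E`; `E ≅ RatFunc M` as `M`-algebras because
`t` is transcendental (`RatFunc.algEquivOfTranscendental`), so `L₀` is a perfect purely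
inseparable `RatFunc M`-algebra and the kernel resolves over `L₀`. Finally `L` is algebraic over
`E ⊆ L₀`, hence over the PERFECT `L₀`, and the landed degenerate case of the climb
(`stub_climbAlgebraic`, p154863: resolution passes along algebraic extensions of perfect fields)
carries resolution from `L₀` to `L`.

## Sources

* Q. Liu, *Algebraic Geometry and Arithmetic Curves* (2002), Prop. 3.2.7, Cor. 4.3.33. [Liu2002]
* Mathlib: `RatFunc.algEquivOfTranscendental`, `perfectClosure`, `IsPurelyInseparable.trans`,
  `Algebra.IsAlgebraic.tower_top`.
-/

noncomputable section

set_option linter.dupNamespace false -- mandated namespace of this single-conjunct summit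

open CategoryTheory CategoryTheory.Limits AlgebraicGeometry
open Literature.AlgebraicGeometry.Resolution

namespace Summit.ResolutionOfSingularities.ResolutionOfSingularities.Theorems.PrimeFieldToPerfect

/-- **The transfer kernel reduces to the perfect closure of the rational function field.** If,
for every perfect `M` of characteristic `p` with resolution of all integral separated finite-type
`M`-schemes, resolution holds over every perfect field purely inseparable over `RatFunc M`, then
it holds over every perfect `L ⊇ M` of characteristic `p` algebraic over `M⟮t⟯` for a
transcendental `t ∈ L` (the registered stub `stub_climbTranscendental` of the crux skeleton,
RESHAPE 3, verbatim as conclusion). Proof: resolve over `L₀ := perfectClosure M⟮t⟯ L`, a perfect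
purely inseparable algebra over `M⟮t⟯ ≅ RatFunc M`, then pass to the algebraic extension `L/L₀`
by the landed `stub_climbAlgebraic`. [folklore] -/
theorem climbTranscendental_of_climbRatFuncPerf
    (hR : ∀ p : ℕ, p.Prime → ∀ (M : Type) [Field M] [CharP M p] [PerfectField M],
      (∀ (X : Scheme.{0}) (f : X ⟶ Spec (.of M)), IsSeparated f → LocallyOfFiniteType f →
        QuasiCompact f → IsIntegral X → Scheme.HasResolution X) →
      ∀ (L : Type) [Field L] [PerfectField L] [Algebra (RatFunc M) L]
        [IsPurelyInseparable (RatFunc M) L]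
        (X : Scheme.{0}) (f : X ⟶ Spec (.of L)), IsSeparated f → LocallyOfFiniteType f →
          QuasiCompact f → IsIntegral X → Scheme.HasResolution X)
    (p : ℕ) (hp : p.Prime)
    (M : Type) [Field M] [CharP M p] [PerfectField M]
    (hM : ∀ (X : Scheme.{0}) (f : X ⟶ Spec (.of M)), IsSeparated f → LocallyOfFiniteType f →
      QuasiCompact f → IsIntegral X → Scheme.HasResolution X)
    (L : Type) [Field L] [CharP L p] [PerfectField L] [Algebra M L] (t : L)
    (htr : Transcendental M t)
    (ht : Algebra.IsAlgebraic (IntermediateField.adjoin M ({t} : Set L)) L)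
    (X : Scheme.{0}) (f : X ⟶ Spec (.of L)) (hs : IsSeparated f) (hl : LocallyOfFiniteType f)
    (hq : QuasiCompact f) (hX : IsIntegral X) : Scheme.HasResolution X := by
  -- `E = M⟮t⟯ ⊆ L` and its relative perfect closure `L₀` in `L`
  let E : IntermediateField M L := IntermediateField.adjoin M ({t} : Set L)
  let L₀ : IntermediateField E L := perfectClosure E L
  haveI : PerfectField L₀ := inferInstanceAs (PerfectField (perfectClosure E L))
  haveI : IsPurelyInseparable E L₀ := perfectClosure.isPurelyInseparable E L
  -- `RatFunc M ≅ E` (t transcendental) makes `L₀` a purely inseparable `RatFunc M`-algebra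
  let e : RatFunc M ≃ₐ[M] E := RatFunc.algEquivOfTranscendental t htr
  letI : Algebra (RatFunc M) E := (e : RatFunc M →+* E).toAlgebra
  letI : Algebra (RatFunc M) L₀ := ((algebraMap E L₀).comp (e : RatFunc M →+* E)).toAlgebra
  haveI : IsScalarTower (RatFunc M) E L₀ := IsScalarTower.of_algebraMap_eq fun _ => rfl
  haveI : IsPurelyInseparable (RatFunc M) E :=
    { isIntegral := Algebra.isIntegral_of_surjective (fun x => ⟨e.symm x, e.apply_symm_apply x⟩)
      inseparable' := fun x _ => ⟨e.symm x, e.apply_symm_apply x⟩ }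
  haveI : IsPurelyInseparable (RatFunc M) L₀ := IsPurelyInseparable.trans (RatFunc M) E L₀
  -- the kernel: resolution over `L₀ ≅ (RatFunc M)^{perf}`
  have hL₀ : ∀ (Y : Scheme.{0}) (g : Y ⟶ Spec (.of L₀)), IsSeparated g → LocallyOfFiniteType g →
      QuasiCompact g → IsIntegral Y → Scheme.HasResolution Y :=
    fun Y g hs hl hq hY => hR p hp M hM L₀ Y g hs hl hq hY
  -- `L` is algebraic over `E ⊆ L₀`, hence over the perfect `L₀`: the landed algebraic case
  haveI : Algebra.IsAlgebraic E L := ht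
  haveI : Algebra.IsAlgebraic L₀ L := Algebra.IsAlgebraic.tower_top (K := E) L₀
  exact stub_climbAlgebraic L₀ hL₀ L X f hs hl hq hX

end Summit.ResolutionOfSingularities.ResolutionOfSingularities.Theorems.PrimeFieldToPerfect

end
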